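import Literature.MathematicalPhysics.QuantumFieldTheory.Balaban1983to89.B4TwoRegion120
import Literature.MathematicalPhysics.QuantumFieldTheory.Balaban1983to89.B4Prop23ZeroBox

/-!
# `Balaban1983to89.B4Prop23ZeroRegion` — LEAF `b4` CONJUNCT 2: «Proposition 2.3 of [1]» (`B4.Prop23Printed`) PROVED for
# the ZERO-FIELD carriers on GENERAL NESTED BLOCK UNIONS `Ω ⊂ Ω₀` (the print's regions, beyond nested boxes and tori)

**Source.** T. Bałaban, *Regularity and Decay of Lattice Green's Functions*, Commun. Math. Phys. **89**, 571–597 (1983)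
(bib key `Balaban1983RegularityDecay`, «B4» of the 1983–89 series), p. 572 [PDF 2] (the regions), p. 573 [PDF 3]
(1.13)–(1.14), p. 574 [PDF 4] Proposition 2.3 of [1], formulas (1.15)–(1.20) (journal page = PDF page + 570; renders
`b2b-balaban-ref1/pages/1983-cmp89-regularity-decay/1983-cmp89-regularity-decay-p002-x2.png`, `-p003-x2.png`,
`-p004-x2.png`, read as images).  A sibling of `B4Prop23ZeroBox` (the same typed statement for nested Neumann BOXES);
no existing module is touched; nothing of B4 is asserted.

## WHAT IS PRINTED (verbatim; `≦` of the print written `≤`)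

p. 572: «We consider also a second division of ηZ^d into cubes of size M called big blocks. […] We consider subsets Ω
which are unions of big blocks.»

p. 573: «This theorem implies in particular the Proposition 2.3 of [1]. It concerns unit lattice Green's functions
C_Λ^{(k)}(Ω, A) of [1]. Let us recall that for operators X defined on the unit lattice functions we define the operator
X|_Λ restricted to a subset Λ by X|_Λ = ΛXΛ, where Λ also denotes the characteristic function of the set Λ. We have
C_Λ^{(k)}(Ω, A) = ((Δ^{(k)}(Ω, A) + aL^{−2}P(A))|_Λ)^{−1}.   (1.13)
Here Δ^{(k)}(Ω, A) is an operator of the effective Gaussian action after k renormalization transformations and can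
be defined by  Δ^{(k)}(Ω, A) = a_kI − a_k²Q_k(A)G_k(Ω, A)Q_k^*(A),   (1.14)  where a_k is a constant proportional to a.»

p. 574: «**Proposition 2.3 of [1].** There exist positive constants δ₀, c₀, γ₀, γ₁ dependent on d and M only and such
that for arbitrary Λ ⊂ Ω^{(k)} = Ω∩Z^d, Λ being a sum of big blocks and for e sufficiently small, we have
γ₀I ≤ Δ^{(k)}(Ω, A) + aL^{−2}P(A) ≤ γ₁I,   (1.15)
|C_Λ^{(k)}(Ω, A; x, x′)| ≤ c₀ exp(−δ₀|x − x′|),  x, x′ ∈ Λ.   (1.16)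
In particular the above inequality holds for C^{(k)}(Ω, A). Putting
δC_Λ^{(k)}(Ω, A) = C_Λ^{(k)}(Ω, A) − C^{(k)}(Ω, A),   (1.17)
we have also
|δC_Λ^{(k)}(Ω, A; x, x′)| ≤ c₀ exp(−δ₀(|x − x′| + dist(x, Λ^c) + dist(x′, Λ^c))),  x, x′ ∈ Λ.   (1.18)
Finally, for Ω ⊂ Ω₀ and
δC_Λ^{(k)}(Ω, Ω₀, A) = C_Λ^{(k)}(Ω, A) − C_Λ^{(k)}(Ω₀, A),   (1.19)
we have
|δC_Λ^{(k)}(Ω, Ω₀, A; x, x′)| ≤ c₀ exp(−δ₀(|x−x′| + dist(x, Ω^{(k)c}) + dist(x′, Ω^{(k)c}))),  x, x′ ∈ Λ.   (1.20)»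

## WHAT THIS FILE CERTIFIES (kernel-checked, zero `sorry`, no hypotheses; the lineage is USED BY NAME, not re-proved)

The package types «Proposition 2.3 of [1]» verbatim as the `Prop`-valued `B4.Prop23Printed (fam : I → B4.UnitSetting)`
(module `…Balaban1983to89.B4`, surge node T01.2 = leaf `b4`, conjunct 2 of `B4.LeafB4` in `DagBinding`), quantified
over an ABSTRACT family of unit-lattice settings.  `B4Prop23ZeroBox` made it a theorem for the zero-field NESTED-BOX
family, `DagDischarged` (v11) also for the periodic family.  This file exhibits the zero-field family ON THE PRINT'S
GENERAL REGIONS — nested finite unions `Ω ⊂ Ω₀` of `L`-blocks of unit sites, of any shape — for which the typed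
statement is a THEOREM, in two readings of the printed complements:
* `ZeroRegionIdx d ℓ a₋ a₊ m²₊ a₂₋ a₂₊` (§2) indexes every zero-field nested-region instance in dimension `d + 1` with
  block size `L = ℓ + 1`: mesh `n ≥ 1` (`η = 1/n`; in the print `n = L^k`), constants `a_k ∈ [a₋, a₊]`,
  `m_k² ∈ [0, m²₊]`, `a ∈ [a₂₋, a₂₊]`, two NESTED FINITE SETS OF UNIT SITES `Ω ⊆ Ω₀ ⊂ ℤ^{d+1}` each a union of
  `L`-blocks (`B4Lower18.IsBlockUnion (ℓ+1)`; they ARE `Ω^{(k)} ⊆ Ω₀^{(k)}`), an arbitrary finite `Λ ⊆ Ω^{(k)}`, and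
  a charge `e` (which enters no operator at `A = 0`);
* `zeroFieldRegions … : ZeroRegionIdx … → B4.UnitSetting` (§2) fills the carriers of `B4.UnitSetting` with the
  lineage's `A = 0` objects on block unions (`B4RegionCov1518.covR` = `Δ^{(k)}(Ω, 0) + aL^{−2}P(0)` on `ℓ²(Ω^{(k)})`,
  `covRSub … e` = its compression `X|_Λ` along an injection `e`, `(·)⁻¹` = `Matrix.inv`, which IS the inverse by
  `B4RegionCov1518.cov116_region_finset_decay`'s first conjunct), with `dist(x, Λ^c)` READ INSIDE `Ω^{(k)}`
  (`B4RegionCov1518.distCS`) and `dist(x, Ω^{(k)c})` READ as `dist_∞(x, Ω₀^{(k)} ∖ Ω^{(k)})` (`B4TwoRegion120.dSet`) —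
  the lineage's typed (stronger) weights, see the DICTIONARY;
* `prop23Printed_zeroFieldRegions` (§3): **`B4.Prop23Printed (zeroFieldRegions d ℓ a₋ a₊ m²₊ a₂₋ a₂₊)`** for every
  `d`, every `ℓ ≥ 1` and every window with `a₋ > 0`, `a₂₋ > 0` — assembled from the lineage's kernel certificates
  `B4RegionCov1518.cov115_region_form_bounds` ((1.15) on every block union), `…cov116_region_finset_decay` ((1.16) for
  every `Λ ⊆ Ω^{(k)}`), `…cov118_region_finset_delta` ((1.17)–(1.18)), `B4TwoRegion120.cov120_region_finset_delta`
  ((1.19)–(1.20) for nested block unions, the print's Section-5 route), with ONE set of constants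
  `δ₀ = min(δ_(1.16), δ_(1.18), δ_(1.20))`, `c₀ = max(c_(1.16), c_(1.18), c_(1.20))` (`B4Prop23ZeroBox.exp_bound_weaken`)
  and the threshold `e₁ = 1`;
* §4 — **THE LITERAL COMPLEMENTS**: `dCompl S x = inf{|x − v|_∞ : v ∈ ℤ^{d+1} ∖ S}` (§4), the sup-distance to the
  set-theoretic complement IN `ℤ^{d+1}`; `zeroFieldRegionsLit` = the same carriers with `distLc x = dCompl Λ x`
  (`Λ^c = ℤ^{d+1} ∖ Λ`) and `distOc x = dCompl Ω^{(k)} x` (`Ω^{(k)c} = ℤ^{d+1} ∖ Ω^{(k)}`), and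
  `prop23Printed_zeroFieldRegionsLit`: **`B4.Prop23Printed (zeroFieldRegionsLit d ℓ a₋ a₊ m²₊ a₂₋ a₂₊)`** with the same
  constants — by `dCompl Λ ≤ distCS Λ` (`ℤ^{d+1} ∖ Λ ⊇ Ω^{(k)} ∖ Λ`) and `dCompl Ω^{(k)} ≤ dSet (Ω₀^{(k)} ∖ Ω^{(k)})`
  whenever the smaller sets are nonempty, and by the EXACT VANISHING of `δC_Λ^{(k)}(Ω, 0)` for `Λ = Ω^{(k)}`
  (`covRSub_inv_of_forall_mem`, `Matrix.inv_submatrix_equiv`) resp. of `δC_Λ^{(k)}(Ω, Ω₀, 0)` for `Ω = Ω₀`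
  (`covRSub_incl_eq`) in the degenerate cases where the typed weights take the junk value `inf ∅ = 0`;
* §5: the index type of the physical window `d + 1 = 4`, `L = 2` is inhabited by a NON-BOX nested pair (one `2`-block
  inside an `L`-shaped union of three `2`-blocks, `idxL`, `e = 1`; hypotheses `regular`, `bigBlocks`, `0 < e ≤ e₁` all
  met), so neither typed statement is vacuously discharged.

## DICTIONARY (typist's; each line is a reading, not a quotation; all at `A = 0`)

* `k` ↦ the mesh `n` (`η = 1/n`, print `n = L^k`); `L` ↦ `ℓ + 1`; `Ω ⊂ Ω₀` «unions of big blocks» ↦ two nested finite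
  sets of unit sites `i.Ω ⊆ i.Ω₀` (`Finset (Fin (d+1) → ℤ)`, `i.hsub`), each closed under «same `L`-block»
  (`IsBlockUnion (ℓ+1)`: the case `L ∣ M` of «big blocks», as in `B4RegionCov1518`/`B4TwoRegion120`); they ARE
  `Ω^{(k)} = Ω∩Z^d ⊆ Ω₀^{(k)}`, the fine regions being `B4Lower18.fineDom n ·` (Neumann boundary conditions,
  `B4Prop31Zero`); `ι = B4TwoRegion120.incl i.hsub` is the inclusion `Ω^{(k)} ⊂ Ω₀^{(k)}`.
* `Λ ⊂ Ω^{(k)}` ↦ `i.Λ : Finset ↥i.Ω`, `LSite = ↥i.Λ`; `|x − x′|` ↦ `B4ContourShift.supNorm (x − x′)` (sup norm; the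
  print's norm in the exponents is Euclidean — equivalent up to `√(d+1)` in `δ₀`, cf. `B4BoxCov237` HONEST SCOPE).
* `Δ^{(k)}(Ω, A) + aL^{−2}P(A)` ↦ `covR i.n (ℓ+1) i.a₁ i.a₂ i.m2 i.Ω` (`= B4Prop31Zero.KeffR + (a/L²)·projL`,
  `B4RegionCov1518` DICTIONARY); `C_Λ^{(k)}(Ω, A; x, x′)` ↦ `(covRSub … i.Ω (fun y : ↥i.Λ => y.1))⁻¹ x x′`;
  `C^{(k)}(Ω, A; x, x′)` ↦ `(covR … i.Ω)⁻¹ x.1 x′.1`; `C_Λ^{(k)}(Ω₀, A; x, x′)` ↦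
  `(covRSub … i.Ω₀ (fun y : ↥i.Λ => incl i.hsub y.1))⁻¹ x x′` (`Λ` transported into `Ω₀^{(k)}` by `ι`); (1.17) ↦
  `kerDC`, (1.19) ↦ `kerDC0`, (1.16) ↦ `kerC` (absolute values of the entries).
* (1.15) ↦ `form115 γ₀ γ₁ := ∀ ψ : Ω^{(k)} → ℝ, γ₀(ψ⬝ψ) ≤ ψ⬝(covR …)ψ ∧ ψ⬝(covR …)ψ ≤ γ₁(ψ⬝ψ)`.
* `dist(x, Λ^c)` ↦ `distCS i.Λ x` = `inf{|x − z|_∞ : z ∈ Ω^{(k)} ∖ Λ}` in `zeroFieldRegions` (complement INSIDE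
  `Ω^{(k)}`, where the operators live; `inf ∅ = 0`), and ↦ `dCompl (Subtype.val '' ↑i.Λ) x` = `inf{|x − v|_∞ :
  v ∈ ℤ^{d+1} ∖ Λ}` in `zeroFieldRegionsLit` (complement in the unit lattice `Z^d` of the print); `dist(x, Ω^{(k)c})` ↦
  `dSet (i.Ω₀ \ i.Ω) x` (typed: distance to `Ω₀^{(k)} ∖ Ω^{(k)}`, the set where the two operators differ) resp.
  `dCompl ↑i.Ω x` (literal: distance to `Z^d ∖ Ω^{(k)}`).  Since `Ω^{(k)} ∖ Λ ⊆ Z^d ∖ Λ` and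
  `Ω₀^{(k)} ∖ Ω^{(k)} ⊆ Z^d ∖ Ω^{(k)}`, the literal weights are the SMALLER ones and the literal bounds the WEAKER ones,
  except in the degenerate cases `Λ = Ω^{(k)}` / `Ω = Ω₀`, where the differences (1.17) / (1.19) vanish identically (§4).
* «A satisfying (1.7)» ↦ `regular := True` (at `A = 0` (1.7) reads `0 ≤ …`); «Λ being a sum of big blocks» ↦
  `bigBlocks := True` (see HONEST SCOPE); «e sufficiently small» ↦ the binders `0 < e ≤ e₁` of `B4.Prop23Printed`, met
  with `e₁ = 1` and unused (no operator depends on `e` at `A = 0`).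

## HONEST SCOPE — what is NOT certified here

(i) Only `A = 0` (`U ≡ 1`): the content of «for e sufficiently small» and of the regularity condition (1.7) — the
whole difficulty of B4 §§2–4 for `A ≠ 0`, the expansions (2.6) ff. — is absent; `regular := True` and the `e`-binders
are discharged trivially.  (ii) The regions are nested finite unions of `L`-blocks of unit sites (the reading `L ∣ M`
of «unions of big blocks»); nothing for infinite regions.  (iii) «Λ being a sum of big blocks» is NOT imposed
(`bigBlocks := True`): the lineage's `A = 0` certificates hold for EVERY finite `Λ ⊆ Ω^{(k)}`, so the discharged
statement is formally stronger than the printed one in this respect and weaker in (i).  (iv) The constants are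
existential (`∃ δ₀ c₀ γ₀ γ₁`), depend on `d`, `ℓ` AND the window `[a₋,a₊]×[0,m²₊]×[a₂₋,a₂₊]` (print: «dependent on d
and M only»; the window dependence is the package's reading of the running constants `a_k`, `m_k²` of (1.3)–(1.6),
the `ℓ`-dependence is the print's silent `L`-dependence, p. 588 «Generally we have to expect that bounds on
C^{(k)}_Λ(Ω,A) will depend on L», census D-b04.4), and no numerical value is claimed.  (v) This file does NOT
discharge the binding's leaf `B4.Prop23Printed X.famU` of `DagBinding`/`DagDischarged` for an ABSTRACT family
`X.famU`; it is offered to the DAG carver as the zero-field GENERAL-REGION instance of conjunct 2 (pattern of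
`B4Prop23ZeroBox.prop23Printed_zeroFieldBoxes`), and `DagDischarged` is not edited here (one writer).  (vi) Sup norm
instead of the Euclidean norm in the exponents (equivalent up to `√(d+1)`).  (vii) The proofs of (1.15)–(1.20) at
`A = 0` are the lineage's (`B4RegionCov1518`: Combes–Thomas + the Section 5 Theorem; `B4TwoRegion120`: energy
comparison + (5.5) + Theorem (5.10)); this file is bookkeeping over them and proves only the elementary complement
comparisons and degenerate-case identities of §4.

**Value = kernel certificate (bookkeeping over the package's own `A = 0` theorems on general block unions), NOT summit
progress**: the Yang–Mills / `Summit.QuantumFields` statements are untouched; no Literature fact is minted — every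
hypothesis used is kernel-proved in this package.
-/

namespace Literature.MathematicalPhysics.QuantumFieldTheory.Balaban1983to89.B4Prop23ZeroRegion

open Finset Matrix
open Literature.MathematicalPhysics.QuantumFieldTheory.Balaban1983to89
open Literature.MathematicalPhysics.QuantumFieldTheory.Balaban1983to89.B4ContourShift (supNorm supNorm_nonneg)
open Literature.MathematicalPhysics.QuantumFieldTheory.Balaban1983to89.B4Lower18 (IsBlockUnion fineDom
  fineDom_isBlockUnion)
open Literature.MathematicalPhysics.QuantumFieldTheory.Balaban1983to89.B4RegionCov1518 (covR covRSub covRSub_apply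
  distCS distCS_nonneg distCS_le cov115_region_form_bounds cov116_region_finset_decay cov118_region_finset_delta)
open Literature.MathematicalPhysics.QuantumFieldTheory.Balaban1983to89.B4TwoRegion120 (incl incl_val incl_injective
  dSet dSet_nonneg dSet_le fineDom_mono cov120_region_finset_delta)
open Literature.MathematicalPhysics.QuantumFieldTheory.Balaban1983to89.B4Prop23ZeroBox (exp_bound_weaken)

noncomputable section

variable {d : ℕ}

/-! ## §1  Elementary comparison of exponential bounds -/

/-- `c e^{−δt} ≤ c e^{−δt′}` for `t′ ≤ t`, `c, δ ≥ 0` (a smaller weight gives a weaker bound). [folklore] -/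
theorem exp_bound_mono_weight {c δ t t' : ℝ} (hc : 0 ≤ c) (hδ : 0 ≤ δ) (h : t' ≤ t) :
    c * Real.exp (-(δ * t)) ≤ c * Real.exp (-(δ * t')) :=
  mul_le_mul_of_nonneg_left (Real.exp_le_exp.2 (neg_le_neg (mul_le_mul_of_nonneg_left h hδ))) hc

/-! ## §2  The zero-field nested-region carriers of `B4.UnitSetting` -/

/-- **INDEX OF THE ZERO-FIELD NESTED-REGION INSTANCES** of «Proposition 2.3 of [1]» in dimension `d + 1`, block size
`L = ℓ + 1`, over the window `a_k ∈ [a₋, a₊]`, `m_k² ∈ [0, m²₊]`, `a ∈ [a₂₋, a₂₊]`: a mesh `n ≥ 1` (`η = 1/n`; fields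
`n`, `hn`), the constants `a₁ = a_k` of (1.14), `m2 = m_k²`, `a₂ = a` of `aL^{-2}P` (with their window hypotheses),
two NESTED FINITE SETS OF UNIT SITES `Ω ⊆ Ω₀` (`hsub`), each a union of `L`-blocks (`hΩ`, `hΩ₀` : «unions of big
blocks», p. 572, in the reading `L ∣ M`) — they are `Ω^{(k)} ⊆ Ω₀^{(k)}` —, the subset `Λ ⊆ Ω^{(k)}` of unit sites
(a `Finset`), and the charge `e` (which enters no operator at `A = 0`).
[cite: Balaban1983RegularityDecay, p. 572 («We consider subsets Ω which are unions of big blocks»), p. 574 Prop. 2.3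
(«for arbitrary Λ ⊂ Ω^{(k)} = Ω∩Z^d», «for Ω ⊂ Ω₀»), dictionary at A = 0] [folklore] -/
structure ZeroRegionIdx (d ℓ : ℕ) (aminus aplus m2plus a2minus a2plus : ℝ) where
  n : ℕ
  hn : 1 ≤ n
  a₁ : ℝ
  m2 : ℝ
  a₂ : ℝ
  ha₁ : aminus ≤ a₁
  ha₁' : a₁ ≤ aplus
  hm : 0 ≤ m2
  hm' : m2 ≤ m2plus
  ha₂ : a2minus ≤ a₂
  ha₂' : a₂ ≤ a2plus
  Ω : Finset (Fin (d + 1) → ℤ)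
  Ω₀ : Finset (Fin (d + 1) → ℤ)
  hΩ : IsBlockUnion (ℓ + 1) Ω
  hΩ₀ : IsBlockUnion (ℓ + 1) Ω₀
  hsub : Ω ⊆ Ω₀
  Λ : Finset ↥Ω
  e : ℝ

/-- **THE ZERO-FIELD NESTED-REGION CARRIERS OF `B4.UnitSetting`** (dictionary at `A = 0`, `Ω ⊂ Ω₀` nested finite
unions of `L`-blocks of unit sites with Neumann boundary conditions on their fine regions): `LSite = Λ`;
`udist x x′ = |x − x′|_∞`; `distLc = dist_∞(·, Ω^{(k)} ∖ Λ)` (`B4RegionCov1518.distCS`: `Λ^c` read inside `Ω^{(k)}`);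
`distOc = dist_∞(·, Ω₀^{(k)} ∖ Ω^{(k)})` (`B4TwoRegion120.dSet (Ω₀ \ Ω)`); `kerC x x′ = |C_Λ^{(k)}(Ω; x, x′)|`,
`kerDC x x′ = |C_Λ^{(k)}(Ω; x, x′) − C^{(k)}(Ω; x, x′)|`, `kerDC0 x x′ = |C_Λ^{(k)}(Ω; x, x′) − C_{ιΛ}^{(k)}(Ω₀; ιx, ιx′)|`
with `C_Λ^{(k)}(Ω) = ((Δ^{(k)}(Ω,0) + aL^{-2}P(0))|_Λ)^{-1} = (covRSub … Ω (fun y : ↥Λ => y.1))⁻¹`,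
`C^{(k)}(Ω) = (covR … Ω)⁻¹`, `ι = incl hsub` the inclusion `Ω^{(k)} ⊂ Ω₀^{(k)}`; `form115 γ₀ γ₁` =
`γ₀‖ψ‖² ≤ ⟨ψ, (Δ^{(k)}(Ω,0) + aL^{-2}P(0))ψ⟩ ≤ γ₁‖ψ‖²` for every `ψ` on `ℓ²(Ω^{(k)})`; `regular := True` ((1.7) at
`A = 0`), `bigBlocks := True` (see HONEST SCOPE: no block structure of `Λ` is imposed).
[cite: Balaban1983RegularityDecay, p. 573 (1.13)–(1.14), p. 574 Prop. 2.3 (1.15)–(1.20), dictionary at A = 0]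
[folklore] -/
def zeroFieldRegions (d ℓ : ℕ) (aminus aplus m2plus a2minus a2plus : ℝ)
    (i : ZeroRegionIdx d ℓ aminus aplus m2plus a2minus a2plus) : B4.UnitSetting where
  LSite := ↥i.Λ
  e := i.e
  regular := True
  bigBlocks := True
  udist := fun y y' => supNorm (y.1.1 - y'.1.1)
  distLc := fun y => distCS i.Λ y.1
  distOc := fun y => dSet (i.Ω₀ \ i.Ω) y.1.1
  kerC := fun y y' => |(covRSub i.n (ℓ + 1) i.a₁ i.a₂ i.m2 i.Ω (fun y : ↥i.Λ => y.1))⁻¹ y y'|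
  kerDC := fun y y' =>
    |(covRSub i.n (ℓ + 1) i.a₁ i.a₂ i.m2 i.Ω (fun y : ↥i.Λ => y.1))⁻¹ y y'
      - (covR i.n (ℓ + 1) i.a₁ i.a₂ i.m2 i.Ω)⁻¹ y.1 y'.1|
  kerDC0 := fun y y' =>
    |(covRSub i.n (ℓ + 1) i.a₁ i.a₂ i.m2 i.Ω (fun y : ↥i.Λ => y.1))⁻¹ y y'
      - (covRSub i.n (ℓ + 1) i.a₁ i.a₂ i.m2 i.Ω₀ (fun y : ↥i.Λ => incl i.hsub y.1))⁻¹ y y'|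
  form115 := fun γ₀ γ₁ => ∀ ψ : ↥i.Ω → ℝ,
    γ₀ * (ψ ⬝ᵥ ψ) ≤ ψ ⬝ᵥ (covR i.n (ℓ + 1) i.a₁ i.a₂ i.m2 i.Ω).mulVec ψ ∧
      ψ ⬝ᵥ (covR i.n (ℓ + 1) i.a₁ i.a₂ i.m2 i.Ω).mulVec ψ ≤ γ₁ * (ψ ⬝ᵥ ψ)

/-! ## §3  The DAG leaf: `B4.Prop23Printed` for the zero-field nested-region carriers -/

/-- **LEAF `b4`, CONJUNCT 2, FOR THE ZERO-FIELD NESTED-REGION CARRIERS**: `B4.Prop23Printed (zeroFieldRegions d ℓ …)` —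
the verbatim-typed «Proposition 2.3 of [1]» (1.15)–(1.20) (`B4.Prop23Printed`, surge node T01.2) HOLDS for the family
of all its `A = 0` instances on NESTED FINITE UNIONS `Ω ⊂ Ω₀` OF `L`-BLOCKS OF UNIT SITES (any shape) in the window,
with ONE set of constants `δ₀, c₀, γ₀, γ₁` depending on `d`, `ℓ` and the window only (threshold `e₁ = 1`, vacuous at
`A = 0`): (1.15) is `B4RegionCov1518.cov115_region_form_bounds`, (1.16) `B4RegionCov1518.cov116_region_finset_decay`,
(1.17)–(1.18) `B4RegionCov1518.cov118_region_finset_delta`, (1.19)–(1.20) `B4TwoRegion120.cov120_region_finset_delta`,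
weakened to `δ₀ = min` and `c₀ = max` of their constants.  Nothing is claimed about `A ≠ 0`.
[cite: Balaban1983RegularityDecay, Prop. 2.3 of [1] (1.15)–(1.20) p.574, case A = 0, nested block unions Ω ⊂ Ω₀
(constants and proofs the package's)] -/
theorem prop23Printed_zeroFieldRegions (d ℓ : ℕ) (hℓ : 1 ≤ ℓ) {aminus aplus m2plus a2minus a2plus : ℝ}
    (ha : 0 < aminus) (ha2 : 0 < a2minus) :
    B4.Prop23Printed (zeroFieldRegions d ℓ aminus aplus m2plus a2minus a2plus) := by
  obtain ⟨γ₀, γ₁, hγ₀, hγ₁, -, H15⟩ := cov115_region_form_bounds d ℓ hℓ aminus aplus m2plus a2minus a2plus ha ha2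
  obtain ⟨δ₁, c₁, hδ₁, hc₁, H16⟩ := cov116_region_finset_decay d ℓ hℓ aminus aplus m2plus a2minus a2plus ha ha2
  obtain ⟨δ₂, c₂, hδ₂, hc₂, H18⟩ := cov118_region_finset_delta d ℓ hℓ aminus aplus m2plus a2minus a2plus ha ha2
  obtain ⟨δ₃, c₃, hδ₃, hc₃, H20⟩ := cov120_region_finset_delta d ℓ hℓ aminus aplus m2plus a2minus a2plus ha ha2
  refine ⟨min δ₁ (min δ₂ δ₃), max c₁ (max c₂ c₃), γ₀, γ₁, 1, lt_min hδ₁ (lt_min hδ₂ hδ₃),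
    lt_max_of_lt_left hc₁, hγ₀, hγ₁, one_pos, ?_⟩
  intro i _ _ _ _
  refine ⟨?_, ?_, ?_, ?_⟩
  · -- (1.15)
    intro ψ
    exact H15 i.n i.hn i.a₁ i.m2 i.a₂ i.ha₁ i.ha₁' i.hm i.hm' i.ha₂ i.ha₂' i.Ω i.hΩ ψ
  · -- (1.16)
    intro y y'
    have h := (H16 i.n i.hn i.a₁ i.m2 i.a₂ i.ha₁ i.ha₁' i.hm i.hm' i.ha₂ i.ha₂' i.Ω i.hΩ i.Λ).2 y y'
    exact h.trans (exp_bound_weaken (supNorm_nonneg _) hc₁.le (le_max_left _ _) (min_le_left _ _))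
  · -- (1.17)–(1.18)
    intro y y'
    have h := H18 i.n i.hn i.a₁ i.m2 i.a₂ i.ha₁ i.ha₁' i.hm i.hm' i.ha₂ i.ha₂' i.Ω i.hΩ i.Λ y y'
    refine h.trans (exp_bound_weaken ?_ hc₂.le ((le_max_left _ _).trans (le_max_right _ _))
      ((min_le_right _ _).trans (min_le_left _ _)))
    have := supNorm_nonneg (y.1.1 - y'.1.1)
    have := distCS_nonneg i.Λ y.1
    have := distCS_nonneg i.Λ y'.1
    positivity
  · -- (1.19)–(1.20)
    intro y y'
    have h := H20 i.n i.hn i.a₁ i.m2 i.a₂ i.ha₁ i.ha₁' i.hm i.hm' i.ha₂ i.ha₂' i.Ω i.Ω₀ i.hΩ i.hΩ₀ i.hsub i.Λ y y'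
    refine h.trans (exp_bound_weaken ?_ hc₃.le ((le_max_right _ _).trans (le_max_right _ _))
      ((min_le_right _ _).trans (min_le_right _ _)))
    have := supNorm_nonneg (y.1.1 - y'.1.1)
    have := dSet_nonneg (i.Ω₀ \ i.Ω) y.1.1
    have := dSet_nonneg (i.Ω₀ \ i.Ω) y'.1.1
    positivity

/-! ## §4  The literal complements `Λ^c = Z^d ∖ Λ`, `Ω^{(k)c} = Z^d ∖ Ω^{(k)}` and the degenerate cases -/

/-- the sup-distance from a unit site `x` to the COMPLEMENT IN `ℤ^{d+1}` of a set `S` of unit sites,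
`inf{|x − v|_∞ : v ∉ S}` (the literal `dist(x, S^c)` of the print; `inf ∅ = 0` if `S = ℤ^{d+1}`).
[cite: Balaban1983RegularityDecay, p. 574 (1.18) («dist(x, Λ^c)»), (1.20) («dist(x, Ω^{(k)c})»), dictionary]
[folklore] -/
def dCompl (S : Set (Fin (d + 1) → ℤ)) (x : Fin (d + 1) → ℤ) : ℝ :=
  sInf ((fun v => supNorm (x - v)) '' Sᶜ)

/-- `dist(x, S^c) ≥ 0`. [folklore] -/
theorem dCompl_nonneg (S : Set (Fin (d + 1) → ℤ)) (x : Fin (d + 1) → ℤ) : 0 ≤ dCompl S x := by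
  unfold dCompl
  apply Real.sInf_nonneg
  rintro _ ⟨v, -, rfl⟩
  exact supNorm_nonneg _

/-- `dist(x, S^c) ≤ |x − v|_∞` for every `v ∉ S`. [folklore] -/
theorem dCompl_le {S : Set (Fin (d + 1) → ℤ)} (x : Fin (d + 1) → ℤ) {v : Fin (d + 1) → ℤ} (hv : v ∉ S) :
    dCompl S x ≤ supNorm (x - v) := by
  unfold dCompl
  exact csInf_le ⟨0, by rintro _ ⟨w, -, rfl⟩; exact supNorm_nonneg _⟩ ⟨v, hv, rfl⟩

/-- **`dist(x, Z^d ∖ Λ) ≤ dist(x, Ω^{(k)} ∖ Λ)`** whenever `Λ ≠ Ω^{(k)}`: the literal weight of (1.18) is at most the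
typed one (`B4RegionCov1518.distCS`), because `Ω^{(k)} ∖ Λ ⊆ Z^d ∖ Λ`. [folklore] -/
theorem dCompl_le_distCS {Ω : Finset (Fin (d + 1) → ℤ)} (Λ : Finset ↥Ω) (hΛ : ∃ z : ↥Ω, z ∉ Λ) (y : ↥Ω) :
    dCompl (Subtype.val '' (↑Λ : Set ↥Ω)) y.1 ≤ distCS Λ y := by
  obtain ⟨z₀, hz₀⟩ := hΛ
  unfold distCS
  refine le_csInf ?_ ?_
  · exact ⟨_, ⟨z₀, hz₀, rfl⟩⟩
  rintro _ ⟨z, hz, rfl⟩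
  apply dCompl_le
  rintro ⟨w, hw, hwz⟩
  have hwz' : w = z := Subtype.ext hwz
  subst hwz'
  exact hz (Finset.mem_coe.1 hw)

/-- **`dist(x, Z^d ∖ Ω^{(k)}) ≤ dist(x, Ω₀^{(k)} ∖ Ω^{(k)})`** whenever `Ω^{(k)} ≠ Ω₀^{(k)}`: the literal weight of (1.20)
is at most the typed one (`B4TwoRegion120.dSet (Ω₀ \ Ω)`), because `Ω₀^{(k)} ∖ Ω^{(k)} ⊆ Z^d ∖ Ω^{(k)}`. [folklore] -/
theorem dCompl_le_dSet {Ω Ω₀ : Finset (Fin (d + 1) → ℤ)} (hne : (Ω₀ \ Ω).Nonempty) (x : Fin (d + 1) → ℤ) :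
    dCompl (↑Ω : Set (Fin (d + 1) → ℤ)) x ≤ dSet (Ω₀ \ Ω) x := by
  obtain ⟨v₀, hv₀⟩ := hne
  unfold dSet
  refine le_csInf ?_ ?_
  · exact ⟨_, ⟨v₀, Finset.mem_coe.2 hv₀, rfl⟩⟩
  rintro _ ⟨v, hv, rfl⟩
  exact dCompl_le x (fun hvΩ => (Finset.mem_sdiff.1 (Finset.mem_coe.1 hv)).2 (Finset.mem_coe.1 hvΩ))

/-- **THE DEGENERATE CASE `Λ = Ω^{(k)}` OF (1.17): `C_Λ^{(k)}(Ω) = C^{(k)}(Ω)` entrywise**, i.e. `δC_Λ^{(k)}(Ω, 0) = 0` —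
the compression along a BIJECTION commutes with inversion (`Matrix.inv_submatrix_equiv`). [folklore] -/
theorem covRSub_inv_of_forall_mem {Ω : Finset (Fin (d + 1) → ℤ)} (Λ : Finset ↥Ω) (hΛ : ∀ z : ↥Ω, z ∈ Λ)
    (n L : ℕ) (a₁ a₂ m2 : ℝ) (y y' : ↥Λ) :
    (covRSub n L a₁ a₂ m2 Ω (fun y : ↥Λ => y.1))⁻¹ y y' = (covR n L a₁ a₂ m2 Ω)⁻¹ y.1 y'.1 := by
  let E : ↥Λ ≃ ↥Ω := Equiv.ofBijective (fun y : ↥Λ => y.1)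
    ⟨fun a b h => Subtype.ext h, fun z => ⟨⟨z, hΛ z⟩, rfl⟩⟩
  have hE : covRSub n L a₁ a₂ m2 Ω (fun y : ↥Λ => y.1) = (covR n L a₁ a₂ m2 Ω).submatrix E E := rfl
  rw [hE, Matrix.inv_submatrix_equiv]
  rfl

/-- **THE DEGENERATE CASE `Ω = Ω₀` OF (1.19): `C_Λ^{(k)}(Ω₀) = C_Λ^{(k)}(Ω)` as matrices**, i.e. `δC_Λ^{(k)}(Ω, Ω₀, 0) = 0`
(for `Ω ⊆ Ω₀ ⊆ Ω` the two operators coincide and `ι` is the identity). [folklore] -/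
theorem covRSub_incl_eq {Ω Ω₀ : Finset (Fin (d + 1) → ℤ)} (hΩ : Ω₀ ⊆ Ω) (h : Ω ⊆ Ω₀) (n L : ℕ) (a₁ a₂ m2 : ℝ)
    (Λ : Finset ↥Ω) :
    covRSub n L a₁ a₂ m2 Ω₀ (fun y : ↥Λ => incl h y.1) = covRSub n L a₁ a₂ m2 Ω (fun y : ↥Λ => y.1) := by
  obtain rfl : Ω = Ω₀ := Finset.Subset.antisymm h hΩ
  have hι : (fun y : ↥Λ => incl h y.1) = (fun y : ↥Λ => y.1) := funext fun y => Subtype.ext rfl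
  rw [hι]

/-- **THE ZERO-FIELD NESTED-REGION CARRIERS WITH THE LITERAL COMPLEMENTS**: as `zeroFieldRegions`, but
`distLc x = dist_∞(x, Z^d ∖ Λ)` (`dCompl (Subtype.val '' ↑Λ)`) and `distOc x = dist_∞(x, Z^d ∖ Ω^{(k)})` (`dCompl ↑Ω`) —
the complements `Λ^c`, `Ω^{(k)c}` of (1.18), (1.20) taken literally in the unit lattice `Z^d`.
[cite: Balaban1983RegularityDecay, p. 574 Prop. 2.3 (1.18) («dist(x, Λ^c)»), (1.20) («dist(x, Ω^{(k)c})»), dictionary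
at A = 0] [folklore] -/
def zeroFieldRegionsLit (d ℓ : ℕ) (aminus aplus m2plus a2minus a2plus : ℝ)
    (i : ZeroRegionIdx d ℓ aminus aplus m2plus a2minus a2plus) : B4.UnitSetting where
  LSite := ↥i.Λ
  e := i.e
  regular := True
  bigBlocks := True
  udist := fun y y' => supNorm (y.1.1 - y'.1.1)
  distLc := fun y => dCompl (Subtype.val '' (↑i.Λ : Set ↥i.Ω)) y.1.1
  distOc := fun y => dCompl (↑i.Ω : Set (Fin (d + 1) → ℤ)) y.1.1
  kerC := fun y y' => |(covRSub i.n (ℓ + 1) i.a₁ i.a₂ i.m2 i.Ω (fun y : ↥i.Λ => y.1))⁻¹ y y'|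
  kerDC := fun y y' =>
    |(covRSub i.n (ℓ + 1) i.a₁ i.a₂ i.m2 i.Ω (fun y : ↥i.Λ => y.1))⁻¹ y y'
      - (covR i.n (ℓ + 1) i.a₁ i.a₂ i.m2 i.Ω)⁻¹ y.1 y'.1|
  kerDC0 := fun y y' =>
    |(covRSub i.n (ℓ + 1) i.a₁ i.a₂ i.m2 i.Ω (fun y : ↥i.Λ => y.1))⁻¹ y y'
      - (covRSub i.n (ℓ + 1) i.a₁ i.a₂ i.m2 i.Ω₀ (fun y : ↥i.Λ => incl i.hsub y.1))⁻¹ y y'|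
  form115 := fun γ₀ γ₁ => ∀ ψ : ↥i.Ω → ℝ,
    γ₀ * (ψ ⬝ᵥ ψ) ≤ ψ ⬝ᵥ (covR i.n (ℓ + 1) i.a₁ i.a₂ i.m2 i.Ω).mulVec ψ ∧
      ψ ⬝ᵥ (covR i.n (ℓ + 1) i.a₁ i.a₂ i.m2 i.Ω).mulVec ψ ≤ γ₁ * (ψ ⬝ᵥ ψ)

/-- **LEAF `b4`, CONJUNCT 2, FOR THE ZERO-FIELD NESTED-REGION CARRIERS WITH THE LITERAL COMPLEMENTS**:
`B4.Prop23Printed (zeroFieldRegionsLit d ℓ …)`, with the constants of `prop23Printed_zeroFieldRegions`.  (1.15), (1.16)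
as there; (1.18): if `Λ ≠ Ω^{(k)}` the typed bound with `dist(·, Ω^{(k)} ∖ Λ)` implies the literal one with the smaller
weight `dist(·, Z^d ∖ Λ)` (`dCompl_le_distCS`), and if `Λ = Ω^{(k)}` then `δC_Λ^{(k)}(Ω, 0) = 0`
(`covRSub_inv_of_forall_mem`); (1.20): if `Ω ≠ Ω₀` the typed bound with `dist(·, Ω₀^{(k)} ∖ Ω^{(k)})` implies the
literal one (`dCompl_le_dSet`), and if `Ω = Ω₀` then `δC_Λ^{(k)}(Ω, Ω₀, 0) = 0` (`covRSub_incl_eq`).  Nothing is claimed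
about `A ≠ 0`.
[cite: Balaban1983RegularityDecay, Prop. 2.3 of [1] (1.15)–(1.20) p.574, case A = 0, nested block unions Ω ⊂ Ω₀,
complements read in Z^d (constants and proofs the package's)] -/
theorem prop23Printed_zeroFieldRegionsLit (d ℓ : ℕ) (hℓ : 1 ≤ ℓ) {aminus aplus m2plus a2minus a2plus : ℝ}
    (ha : 0 < aminus) (ha2 : 0 < a2minus) :
    B4.Prop23Printed (zeroFieldRegionsLit d ℓ aminus aplus m2plus a2minus a2plus) := by
  obtain ⟨γ₀, γ₁, hγ₀, hγ₁, -, H15⟩ := cov115_region_form_bounds d ℓ hℓ aminus aplus m2plus a2minus a2plus ha ha2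
  obtain ⟨δ₁, c₁, hδ₁, hc₁, H16⟩ := cov116_region_finset_decay d ℓ hℓ aminus aplus m2plus a2minus a2plus ha ha2
  obtain ⟨δ₂, c₂, hδ₂, hc₂, H18⟩ := cov118_region_finset_delta d ℓ hℓ aminus aplus m2plus a2minus a2plus ha ha2
  obtain ⟨δ₃, c₃, hδ₃, hc₃, H20⟩ := cov120_region_finset_delta d ℓ hℓ aminus aplus m2plus a2minus a2plus ha ha2
  have hc₀ : 0 ≤ max c₁ (max c₂ c₃) := hc₁.le.trans (le_max_left _ _)
  have hδ₀ : 0 ≤ min δ₁ (min δ₂ δ₃) := (lt_min hδ₁ (lt_min hδ₂ hδ₃)).le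
  refine ⟨min δ₁ (min δ₂ δ₃), max c₁ (max c₂ c₃), γ₀, γ₁, 1, lt_min hδ₁ (lt_min hδ₂ hδ₃),
    lt_max_of_lt_left hc₁, hγ₀, hγ₁, one_pos, ?_⟩
  intro i _ _ _ _
  refine ⟨?_, ?_, ?_, ?_⟩
  · -- (1.15)
    intro ψ
    exact H15 i.n i.hn i.a₁ i.m2 i.a₂ i.ha₁ i.ha₁' i.hm i.hm' i.ha₂ i.ha₂' i.Ω i.hΩ ψ
  · -- (1.16)
    intro y y'
    have h := (H16 i.n i.hn i.a₁ i.m2 i.a₂ i.ha₁ i.ha₁' i.hm i.hm' i.ha₂ i.ha₂' i.Ω i.hΩ i.Λ).2 y y'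
    exact h.trans (exp_bound_weaken (supNorm_nonneg _) hc₁.le (le_max_left _ _) (min_le_left _ _))
  · -- (1.17)–(1.18) with `Λ^c = Z^d ∖ Λ`
    intro y y'
    show |(covRSub i.n (ℓ + 1) i.a₁ i.a₂ i.m2 i.Ω (fun y : ↥i.Λ => y.1))⁻¹ y y'
        - (covR i.n (ℓ + 1) i.a₁ i.a₂ i.m2 i.Ω)⁻¹ y.1 y'.1|
      ≤ max c₁ (max c₂ c₃) * Real.exp (-(min δ₁ (min δ₂ δ₃) * (supNorm (y.1.1 - y'.1.1)
        + dCompl (Subtype.val '' (↑i.Λ : Set ↥i.Ω)) y.1.1 + dCompl (Subtype.val '' (↑i.Λ : Set ↥i.Ω)) y'.1.1)))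
    by_cases hΛ : ∃ z : ↥i.Ω, z ∉ i.Λ
    · have h := H18 i.n i.hn i.a₁ i.m2 i.a₂ i.ha₁ i.ha₁' i.hm i.hm' i.ha₂ i.ha₂' i.Ω i.hΩ i.Λ y y'
      have hT : 0 ≤ supNorm (y.1.1 - y'.1.1) + distCS i.Λ y.1 + distCS i.Λ y'.1 := by
        have := supNorm_nonneg (y.1.1 - y'.1.1)
        have := distCS_nonneg i.Λ y.1
        have := distCS_nonneg i.Λ y'.1
        positivity
      refine (h.trans (exp_bound_weaken hT hc₂.le ((le_max_left _ _).trans (le_max_right _ _))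
        ((min_le_right _ _).trans (min_le_left _ _)))).trans (exp_bound_mono_weight hc₀ hδ₀ ?_)
      have h1 := dCompl_le_distCS i.Λ hΛ y.1
      have h2 := dCompl_le_distCS i.Λ hΛ y'.1
      linarith
    · have hΛ' : ∀ z : ↥i.Ω, z ∈ i.Λ := fun z => of_not_not fun hz => hΛ ⟨z, hz⟩
      rw [covRSub_inv_of_forall_mem i.Λ hΛ', sub_self, abs_zero]
      exact mul_nonneg hc₀ (Real.exp_pos _).le
  · -- (1.19)–(1.20) with `Ω^{(k)c} = Z^d ∖ Ω^{(k)}`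
    intro y y'
    show |(covRSub i.n (ℓ + 1) i.a₁ i.a₂ i.m2 i.Ω (fun y : ↥i.Λ => y.1))⁻¹ y y'
        - (covRSub i.n (ℓ + 1) i.a₁ i.a₂ i.m2 i.Ω₀ (fun y : ↥i.Λ => incl i.hsub y.1))⁻¹ y y'|
      ≤ max c₁ (max c₂ c₃) * Real.exp (-(min δ₁ (min δ₂ δ₃) * (supNorm (y.1.1 - y'.1.1)
        + dCompl (↑i.Ω : Set (Fin (d + 1) → ℤ)) y.1.1 + dCompl (↑i.Ω : Set (Fin (d + 1) → ℤ)) y'.1.1)))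
    rcases Finset.eq_empty_or_nonempty (i.Ω₀ \ i.Ω) with h0 | hne
    · rw [covRSub_incl_eq (Finset.sdiff_eq_empty_iff_subset.1 h0) i.hsub, sub_self, abs_zero]
      exact mul_nonneg hc₀ (Real.exp_pos _).le
    · have h := H20 i.n i.hn i.a₁ i.m2 i.a₂ i.ha₁ i.ha₁' i.hm i.hm' i.ha₂ i.ha₂' i.Ω i.Ω₀ i.hΩ i.hΩ₀ i.hsub
        i.Λ y y'
      have hT : 0 ≤ supNorm (y.1.1 - y'.1.1) + dSet (i.Ω₀ \ i.Ω) y.1.1 + dSet (i.Ω₀ \ i.Ω) y'.1.1 := by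
        have := supNorm_nonneg (y.1.1 - y'.1.1)
        have := dSet_nonneg (i.Ω₀ \ i.Ω) y.1.1
        have := dSet_nonneg (i.Ω₀ \ i.Ω) y'.1.1
        positivity
      refine (h.trans (exp_bound_weaken hT hc₃.le ((le_max_right _ _).trans (le_max_right _ _))
        ((min_le_right _ _).trans (min_le_right _ _)))).trans (exp_bound_mono_weight hc₀ hδ₀ ?_)
      have h1 := dCompl_le_dSet hne y.1.1
      have h2 := dCompl_le_dSet hne y'.1.1
      linarith

/-! ## §5  Non-vacuity: a non-box nested pair at `d + 1 = 4`, `L = 2` -/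

/-- an instance of the index at `d + 1 = 4`, `L = 2`, window `[1/2, 2] × [0, 1] × [1/2, 2]`: mesh `n = 1`, `Ω^{(k)}` =
ONE `2`-block of unit sites (`{0,1}⁴`) inside `Ω₀^{(k)}` = the `L`-SHAPED union of the three `2`-blocks with labels
`0`, `e₁`, `e₂` (not a rectangular parallelepiped), `Λ` = all of `Ω^{(k)}`, `e = 1`. [folklore] -/
def idxL : ZeroRegionIdx 3 1 (1 / 2) 2 1 (1 / 2) 2 where
  n := 1
  hn := le_rfl
  a₁ := 1
  m2 := 0
  a₂ := 1
  ha₁ := by norm_num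
  ha₁' := by norm_num
  hm := le_rfl
  hm' := by norm_num
  ha₂ := by norm_num
  ha₂' := by norm_num
  Ω := fineDom (1 + 1) ({![0, 0, 0, 0]} : Finset (Fin (3 + 1) → ℤ))
  Ω₀ := fineDom (1 + 1) ({![0, 0, 0, 0], ![1, 0, 0, 0], ![0, 1, 0, 0]} : Finset (Fin (3 + 1) → ℤ))
  hΩ := fineDom_isBlockUnion (by norm_num) _
  hΩ₀ := fineDom_isBlockUnion (by norm_num) _
  hsub := fineDom_mono (by norm_num) (Finset.singleton_subset_iff.2 (Finset.mem_insert_self _ _))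
  Λ := Finset.univ
  e := 1

/-- the index type of the physical window is inhabited, so the families quantified over in
`prop23Printed_zeroFieldRegions` / `prop23Printed_zeroFieldRegionsLit` are not empty. [folklore] -/
instance : Nonempty (ZeroRegionIdx 3 1 (1 / 2) 2 1 (1 / 2) 2) := ⟨idxL⟩

/-- non-vacuity: «Proposition 2.3 of [1]» as typed (`B4.Prop23Printed`) holds for the zero-field nested-region family of
the physical window `d + 1 = 4`, `L = 2`, `a_k ∈ [1/2, 2]`, `m_k² ∈ [0, 1]`, `a ∈ [1/2, 2]` (typed complements). -/
example : B4.Prop23Printed (zeroFieldRegions 3 1 (1 / 2) 2 1 (1 / 2) 2) :=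
  prop23Printed_zeroFieldRegions 3 1 le_rfl (by norm_num) (by norm_num)

/-- non-vacuity: the same with the literal complements in `Z^d`. -/
example : B4.Prop23Printed (zeroFieldRegionsLit 3 1 (1 / 2) 2 1 (1 / 2) 2) :=
  prop23Printed_zeroFieldRegionsLit 3 1 le_rfl (by norm_num) (by norm_num)

/-- the hypotheses of the typed statement are met by `idxL` at every threshold `e₁ ≥ 1`: the instance is not excluded
by «for e sufficiently small» as typed, in either family. [folklore] -/
example : (zeroFieldRegions 3 1 (1 / 2) 2 1 (1 / 2) 2 idxL).regular ∧
    (zeroFieldRegions 3 1 (1 / 2) 2 1 (1 / 2) 2 idxL).bigBlocks ∧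
    0 < (zeroFieldRegions 3 1 (1 / 2) 2 1 (1 / 2) 2 idxL).e ∧ (zeroFieldRegions 3 1 (1 / 2) 2 1 (1 / 2) 2 idxL).e ≤ 1 ∧
    (zeroFieldRegionsLit 3 1 (1 / 2) 2 1 (1 / 2) 2 idxL).regular ∧
    (zeroFieldRegionsLit 3 1 (1 / 2) 2 1 (1 / 2) 2 idxL).bigBlocks ∧
    0 < (zeroFieldRegionsLit 3 1 (1 / 2) 2 1 (1 / 2) 2 idxL).e ∧
    (zeroFieldRegionsLit 3 1 (1 / 2) 2 1 (1 / 2) 2 idxL).e ≤ 1 :=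
  ⟨trivial, trivial, by simp [zeroFieldRegions, idxL], by simp [zeroFieldRegions, idxL], trivial, trivial,
    by simp [zeroFieldRegionsLit, idxL], by simp [zeroFieldRegionsLit, idxL]⟩

end

end Literature.MathematicalPhysics.QuantumFieldTheory.Balaban1983to89.B4Prop23ZeroRegion
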